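import Mathlib.Data.Fintype.EquivFin
import Literature.AnabelianGeometry.EtaleTheta.FreeMonoidPerfection
import HarnessLib

/-!
# No isomorphism `(∏_I ℤ_{≥0})^pf ≅ ∏_J ℚ_{≥0}` for infinite `I` ([EtTh] Prop. 3.2 (i), literal reading)

Mochizuki, *The étale theta function …*, Publ. RIMS **45** (2009), Prop. 3.2 (i), PDF p. 70
(printed 296) [cite: MochizukiEtTh2009, Prop 3.2 (i) p.70].  Continuation of
`FreeMonoidPerfection.lean` (which PROVES the identification `(∏_I ℤ_{≥0})^pf ≅ boundedDenom I` with
the bounded-denominator product).  Here: read as the FULL direct product, the printed identification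
is not even abstractly possible once the index set is infinite —

* `isEmpty_mulEquiv_perfection_pi` : `Infinite I → IsEmpty ((∏_I ℤ_{≥0})^pf ≃* ∏_J ℚ_{≥0})` for
  every index type `J`; `isEmpty_mulEquiv_perfection_pi_of_mulEquiv` : the same for any monoid
  `M ≅ ∏_I ℤ_{≥0}`.

Invariant (`HasDisjointSups`, preserved by `≃*`): every sequence of pairwise divisibility-disjoint
elements with a common upper bound has a least upper bound.  It holds in `∏_J ℚ_{≥0}`
(`hasDisjointSups_pi`: pointwise, at each index at most one member is nonzero) and fails in
`boundedDenom I` (`not_hasDisjointSups_boundedDenom`: the family `(1/(k+2)) · e_{i_k}` — any upper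
bound with common denominator `N` is `≥ 1/N > 1/(N+2)` at `i_N`, so it can be strictly decreased
there and is not least).

Consequence for the cell (file `LogDivisorPerfection.lean`): an interface field
`Perfection DIVplus ≃* (Cusp ⊕ Comp → Multiplicative ℚ≥0)` excludes `DIVplus ≅ ∏ ℤ_{≥0}` (Def. 3.1 (i))
whenever `Cusp ⊕ Comp` is infinite, i.e. whenever the dual graph of the special fibre of `Z` has a
loop (`Z_∞ → Z` infinite).  Classical; no side is taken on anything in [IUTchIII].
Seat abc-iut-L2-t6.
-/

noncomputable section

namespace Literature.AnabelianGeometry.EtaleTheta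

open Function Literature.AlgebraicGeometry.Frobenioids Multiplicative

universe u v


/-! ### Divisibility-order vocabulary (any commutative monoid) -/

section DvdOrder

variable {M : Type u} {N : Type v} [CommMonoid M] [CommMonoid N]

/-- Two elements of a commutative monoid are *disjoint* for divisibility if their only common
divisor is `1` (for effective divisors: disjoint supports). [cite: MochizukiEtTh2009, Prop 3.2 (i) p.70] -/
def DvdDisjoint (a b : M) : Prop := ∀ c : M, c ∣ a → c ∣ b → c = 1

/-- `z` is a least upper bound of the set `s` for the divisibility preorder.
[cite: MochizukiEtTh2009, Prop 3.2 (i) p.70] -/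
def IsDvdLUB (s : Set M) (z : M) : Prop := (∀ a ∈ s, a ∣ z) ∧ ∀ w : M, (∀ a ∈ s, a ∣ w) → z ∣ w

variable (M) in
/-- The isomorphism invariant separating `∏ ℚ_{≥0}` from `(∏ ℤ_{≥0})^pf`: every sequence of pairwise
disjoint elements admitting a common upper bound has a least upper bound (for divisibility).
[cite: MochizukiEtTh2009, Prop 3.2 (i) p.70] -/
@[mk_iff] structure HasDisjointSups : Prop where
  /-- every bounded, pairwise disjoint sequence has a least upper bound for divisibility -/
  exists_isDvdLUB : ∀ (y : ℕ → M) (x : M), (∀ k, y k ∣ x) →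
    (∀ k l, k ≠ l → DvdDisjoint (y k) (y l)) → ∃ z : M, IsDvdLUB (Set.range y) z

/-- `HasDisjointSups` is invariant under isomorphisms of monoids. [cite: MochizukiEtTh2009, Prop 3.2 (i) p.70] -/
theorem HasDisjointSups.of_mulEquiv (e : M ≃* N) (h : HasDisjointSups M) : HasDisjointSups N := by
  refine ⟨fun y x hyx hd => ?_⟩
  have hd' : ∀ k l, k ≠ l → DvdDisjoint (e.symm (y k)) (e.symm (y l)) := by
    intro k l hkl c hck hcl
    have h1 : e c ∣ y k := by simpa using map_dvd e hck
    have h2 : e c ∣ y l := by simpa using map_dvd e hcl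
    have h3 : e c = 1 := hd k l hkl (e c) h1 h2
    simpa using congrArg e.symm h3
  obtain ⟨z, hz1, hz2⟩ := h.1 (fun k => e.symm (y k)) (e.symm x) (fun k => map_dvd e.symm (hyx k)) hd'
  refine ⟨e z, ?_, ?_⟩
  · rintro _ ⟨k, rfl⟩
    simpa using map_dvd e (hz1 _ ⟨k, rfl⟩)
  · intro w hw
    have hw' : ∀ a ∈ Set.range (fun k => e.symm (y k)), a ∣ e.symm w := by
      rintro _ ⟨k, rfl⟩
      exact map_dvd e.symm (hw _ ⟨k, rfl⟩)
    simpa using map_dvd e (hz2 (e.symm w) hw')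

end DvdOrder

/-! ### The full product `∏_J ℚ_{≥0}` has disjoint sups -/

section PiNNRat

variable {J : Type u}

/-- Divisibility in `∏_J ℚ_{≥0}` is the pointwise order. [cite: MochizukiEtTh2009, Prop 3.2 (i) p.70] -/
theorem pi_nnrat_dvd_iff {f g : J → Multiplicative ℚ≥0} :
    f ∣ g ↔ ∀ j, toAdd (f j) ≤ toAdd (g j) := by
  constructor
  · rintro ⟨c, rfl⟩ j
    rw [Pi.mul_apply, toAdd_mul]
    exact le_self_add
  · intro h
    refine ⟨fun j => ofAdd (toAdd (g j) - toAdd (f j)), funext fun j => ?_⟩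
    apply toAdd.injective
    rw [Pi.mul_apply, toAdd_mul, toAdd_ofAdd, add_tsub_cancel_of_le (h j)]

/-- In `∏_J ℚ_{≥0}` two disjoint elements have disjoint supports. [cite: MochizukiEtTh2009, Prop 3.2 (i) p.70] -/
theorem eq_zero_or_eq_zero_of_dvdDisjoint {f g : J → Multiplicative ℚ≥0} (h : DvdDisjoint f g)
    (j : J) : toAdd (f j) = 0 ∨ toAdd (g j) = 0 := by
  classical
  let c : J → Multiplicative ℚ≥0 := Pi.mulSingle j (ofAdd (min (toAdd (f j)) (toAdd (g j))))
  have hc : ∀ j', toAdd (c j') = if j' = j then min (toAdd (f j)) (toAdd (g j)) else 0 := by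
    intro j'
    by_cases hj : j' = j
    · subst hj; simp [c]
    · simp [c, hj]
  have h1 : c ∣ f := by
    rw [pi_nnrat_dvd_iff]; intro j'; rw [hc]
    split_ifs with hj
    · subst hj; exact min_le_left _ _
    · exact zero_le
  have h2 : c ∣ g := by
    rw [pi_nnrat_dvd_iff]; intro j'; rw [hc]
    split_ifs with hj
    · subst hj; exact min_le_right _ _
    · exact zero_le
  have h3 := congrFun (h c h1 h2) j
  have h4 : min (toAdd (f j)) (toAdd (g j)) = 0 := by
    have := hc j
    rw [h3, if_pos rfl] at this
    simpa using this.symm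
  rcases min_choice (toAdd (f j)) (toAdd (g j)) with h5 | h5
  · exact Or.inl (h5 ▸ h4)
  · exact Or.inr (h5 ▸ h4)

variable (J) in
/-- **`∏_J ℚ_{≥0}` has disjoint sups**: the pointwise supremum of a pairwise disjoint bounded
sequence takes, at each index, the unique nonzero value occurring there.
[cite: MochizukiEtTh2009, Prop 3.2 (i) p.70] -/
theorem hasDisjointSups_pi : HasDisjointSups (J → Multiplicative ℚ≥0) := by
  classical
  refine ⟨fun y x _ hd => ?_⟩
  let n : J → ℕ := fun j => if h : ∃ k, toAdd (y k j) ≠ 0 then h.choose else 0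
  refine ⟨fun j => y (n j) j, ?_, ?_⟩
  · rintro _ ⟨k, rfl⟩
    rw [pi_nnrat_dvd_iff]
    intro j
    by_cases hk : toAdd (y k j) = 0
    · rw [hk]; exact zero_le
    · have hex : ∃ k, toAdd (y k j) ≠ 0 := ⟨k, hk⟩
      have hn : n j = hex.choose := dif_pos hex
      have hk' : toAdd (y (n j) j) ≠ 0 := by rw [hn]; exact hex.choose_spec
      by_cases hkn : k = n j
      · rw [hkn]
      · exfalso
        rcases eq_zero_or_eq_zero_of_dvdDisjoint (hd k (n j) hkn) j with h0 | h0
        · exact hk h0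
        · exact hk' h0
  · intro w hw
    rw [pi_nnrat_dvd_iff]
    intro j
    exact (pi_nnrat_dvd_iff.mp (hw _ ⟨n j, rfl⟩)) j

end PiNNRat

section Infinite

variable (I : Type u)

/-- **`boundedDenom I` does NOT have disjoint sups when `I` is infinite**: the family
`y_k = (1/(k+2)) · e_{i_k}` (distinct indices `i_k`) is pairwise disjoint and bounded by the constant
`1`, but any common-denominator upper bound can be strictly decreased at a far enough index.
[cite: MochizukiEtTh2009, Prop 3.2 (i) p.70] -/
theorem not_hasDisjointSups_boundedDenom [Infinite I] : ¬ HasDisjointSups (boundedDenom I) := by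
  classical
  intro h
  let ι : ℕ ↪ I := Infinite.natEmbedding I
  let q : ℕ → ℚ≥0 := fun k => 1 / ((k : ℚ≥0) + 2)
  have hq1 : ∀ k, q k ≤ 1 := fun k => by
    rw [div_le_one (by positivity)]
    exact le_add_of_nonneg_of_le zero_le one_le_two
  let y : ℕ → boundedDenom I := fun k => bdSingle I (ι k) (q k)
  have hy : ∀ k i', toAdd ((y k : I → Multiplicative ℚ≥0) i') = if i' = ι k then q k else 0 := by
    intro k i'
    by_cases hi : i' = ι k
    · subst hi; simp [y, bdSingle]
    · simp [y, bdSingle, hi]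
  let x : boundedDenom I := ⟨fun _ => ofAdd 1, ⟨1, fun _ => ⟨1, by simp⟩⟩⟩
  have hyx : ∀ k, y k ∣ x := fun k => (boundedDenom_dvd_iff I).mpr fun i' => by
    rw [hy]
    split_ifs
    · exact hq1 k
    · exact zero_le
  have hd : ∀ k l, k ≠ l → DvdDisjoint (y k) (y l) := by
    intro k l hkl c hck hcl
    rw [boundedDenom_dvd_iff] at hck hcl
    refine Subtype.ext (funext fun i' => toAdd.injective ?_)
    rw [Submonoid.coe_one, Pi.one_apply, toAdd_one]
    have h1 := hck i'
    have h2 := hcl i'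
    rw [hy] at h1 h2
    by_cases hi : i' = ι k
    · have hi' : i' ≠ ι l := fun h' => hkl (ι.injective (hi.symm.trans h'))
      rw [if_neg hi'] at h2
      exact le_antisymm h2 zero_le
    · rw [if_neg hi] at h1
      exact le_antisymm h1 zero_le
  obtain ⟨z, hz1, hz2⟩ := h.1 y x hyx hd
  obtain ⟨N, hN⟩ := z.2
  obtain ⟨m, hm⟩ := hN (ι N)
  -- the upper bound `z` is at least `1/N` at the index `i_N`
  have hzq : q N ≤ toAdd ((z : I → Multiplicative ℚ≥0) (ι N)) := by
    have := (boundedDenom_dvd_iff I).mp (hz1 _ ⟨N, rfl⟩) (ι N)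
    rwa [hy, if_pos rfl] at this
  have hm1 : 1 ≤ m := by
    rcases Nat.eq_zero_or_pos m with h0 | h0
    · exfalso
      rw [hm, h0, Nat.cast_zero, zero_div] at hzq
      exact absurd (le_antisymm hzq zero_le) (by simp [q])
    · exact h0
  have hzN : 1 / ((N : ℕ) : ℚ≥0) ≤ toAdd ((z : I → Multiplicative ℚ≥0) (ι N)) := by
    rw [hm]
    exact div_le_div_of_nonneg_right (by exact_mod_cast hm1) (Nat.cast_nonneg _)
  -- decrease `z` at `i_N` to `1/(N+2)`: still an upper bound
  let w : boundedDenom I := bdUpdate I z (ι N) (q N)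
  have hw : ∀ a ∈ Set.range y, a ∣ w := by
    rintro _ ⟨k, rfl⟩
    rw [boundedDenom_dvd_iff]
    intro i'
    by_cases hi : i' = ι N
    · subst hi
      rw [hy]
      simp only [w, bdUpdate, Function.update_self, toAdd_ofAdd]
      split_ifs with hk
      · rw [ι.injective hk]
      · exact zero_le
    · have := (boundedDenom_dvd_iff I).mp (hz1 _ ⟨k, rfl⟩) i'
      simpa only [w, bdUpdate, Function.update_of_ne hi] using this
  have hzw := (boundedDenom_dvd_iff I).mp (hz2 w hw) (ι N)
  simp only [w, bdUpdate, Function.update_self, toAdd_ofAdd] at hzw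
  have hlt : q N < 1 / ((N : ℕ) : ℚ≥0) := by
    apply div_lt_div_of_pos_left one_pos (Nat.cast_pos.mpr N.pos)
    exact lt_add_of_pos_right _ two_pos
  exact absurd (hzN.trans hzw) (not_le.mpr hlt)

/-- **No isomorphism `(∏_I ℤ_{≥0})^pf ≅ ∏_J ℚ_{≥0}` exists for infinite `I`** (any `J`): the
"direct product of copies of `ℚ_{≥0}`" of Prop. 3.2 (i), read as the full product, is not even
abstractly isomorphic to the perfection of the monoid of effective divisors of Def. 3.1 (i).
[cite: MochizukiEtTh2009, Prop 3.2 (i) p.70] -/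
theorem isEmpty_mulEquiv_perfection_pi [Infinite I] (J : Type u) :
    IsEmpty (Perfection (I → Multiplicative ℕ) ≃* (J → Multiplicative ℚ≥0)) :=
  ⟨fun e => not_hasDisjointSups_boundedDenom I
    (((hasDisjointSups_pi J).of_mulEquiv e.symm).of_mulEquiv (funPerfectionEquiv I))⟩

/-- The same for any monoid isomorphic to a free one: if `M ≅ ∏_I ℤ_{≥0}` with `I` infinite, then
`M^pf ≇ ∏_J ℚ_{≥0}`. [cite: MochizukiEtTh2009, Prop 3.2 (i) p.70] -/
theorem isEmpty_mulEquiv_perfection_pi_of_mulEquiv {M : Type u} [CommMonoid M] [Infinite I]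
    (e : M ≃* (I → Multiplicative ℕ)) (J : Type u) :
    IsEmpty (Perfection M ≃* (J → Multiplicative ℚ≥0)) :=
  ⟨fun e' => (isEmpty_mulEquiv_perfection_pi I J).false ((Perfection.congr e).symm.trans e')⟩

end Infinite

end Literature.AnabelianGeometry.EtaleTheta

end
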